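import Literature.Analysis.FluidPDE.SteadyNSLatticePersistence
import HarnessLib

/-!
# The linearised steady Navier–Stokes operator on the Fourier lattice `ℤ³` with a right-hand side:
# elliptic regularity and the dictionary with the classical resolvent relation
# (Temam 1979, Ch. II §1; Constantin–Foias 1988, Ch. 6–7)

Analysis/FluidPDE proof file (theorems only; no definitions, no named facts), a supplement to
`Literature/Analysis/FluidPDE/SteadyNSLatticePersistence.lean` (`SteadyLattice.*`), which treats
the KERNEL of the linearised lattice operator
`x ↦ 4π²ν x(k) + Π_k (N(û₀, x̌) + N(x̌, û₀))(k)` (`x̌ = cf x`, `Π = Torus.lerayCoeff`,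
`N = ` the convective symbol): `rapidDecay_of_linearised_eq` (regularity of `H²` kernel vectors)
and `isLinNSEigenvalue_of_fourier` (synthesis of a classical eigenvector).  The Lyapunov–Schmidt /
bordering arguments at a DEGENERATE steady state (one-dimensional kernel; Vanderbauwhede 1982
Ch. 8, Dancer 1984) need the same two facts for the INHOMOGENEOUS equation
`4π²ν x(k) + Π_k (N(û₀, x̌) + N(x̌, û₀))(k) = F(k)`, and need the synthesised classical field
together with its Fourier coefficients (not only its existence):

* `rapidDecay_of_linearised_eq_rhs` — if `û₀` is rapidly decaying and transversal, `x ∈ ℓ²` is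
  transversal and `F` is rapidly decaying (in the weighted-`ℓ¹` sense of the bootstrap
  `SteadyNS.tsum_weight_mul_ne_top`), then `x̌` decays rapidly (Temam 1979, Ch. II Prop. 1.1 /
  Constantin–Foias 1988 (7.10)–(7.11), lattice form; the bootstrap applied to `‖û₀‖ + ‖x̌‖` with
  forcing `⟨k⟩₂‖û₀(k)‖ + ‖F(k)‖`);
* `linNSResolventRel_of_fourier` — a rapidly decaying transversal `c` with `c 0 = 0` solving
  `ν·4π²|k|² c(k) + Π_k (N(û₀, c) + N(c, û₀))(k) = −Π_k ĝ(k)` for a smooth `g` with `ĝ(0) = 0`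
  synthesises a classical solution `w` (smooth, divergence free, mean zero, with a smooth pressure)
  of the resolvent relation `L(ν,u₀) w = g` of `LinearizedNSTorus`
  (`Torus.LinNSResolventRel ν u₀ 0 w g`) WITH `𝓕 w = c` (pressure symbol
  `−(k·(M(k) + ĝ(k)))/(2πi|k|²)`; the sign records `𝓕(νΔw) = −ν4π²|k|² ŵ`).

## References

* R. Temam, *Navier–Stokes Equations: Theory and Numerical Analysis*, North-Holland (1979),
  Ch. II §1, Prop. 1.1. [Temam1979]
* P. Constantin, C. Foias, *Navier–Stokes Equations*, Univ. Chicago Press (1988), Ch. 6–7.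
* A. Vanderbauwhede, *Local Bifurcation and Symmetry*, Pitman (1982), Ch. 8. [Vanderbauwhede1982]
-/

noncomputable section

open scoped BigOperators Topology ENNReal NNReal InnerProductSpace ComplexConjugate
open Filter Set Function TopologicalSpace MeasureTheory UnitAddTorus

namespace Literature.Analysis.FluidPDE

namespace SteadyLattice

open Literature.Analysis.FunctionSpaces Literature.Analysis.FunctionSpaces.Torus
open Literature.Analysis.FunctionSpaces.EuclideanSpace
open Literature.Analysis.FluidPDE.ScalarFourier

/-! ## §A Elliptic regularity for the inhomogeneous linearised lattice equation -/

section Regularity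

/-- **Regularity of `H²` solutions of the inhomogeneous linearised lattice equation**: for rapidly
decaying transversal `a`, `x ∈ ℓ²` transversal and a rapidly decaying right-hand side `F`, a solution
of `4π²ν x(k) + Π_k (N(a, x̌) + N(x̌, a))(k) = F(k)` has rapidly decaying `x̌ = cf x` (bootstrap
`SteadyNS.tsum_weight_mul_ne_top` applied to `‖a‖ + ‖x̌‖` with forcing `⟨k⟩₂‖a k‖ + ‖F k‖`).
(adapted from `SteadyLattice.rapidDecay_of_linearised_eq`, the case `F = 0`.) [folklore] -/
theorem rapidDecay_of_linearised_eq_rhs {ν : ℝ} (hν : 0 < ν) {a : (Fin 3 → ℤ) → (EuclideanSpace ℂ (Fin 3))} (ha :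
    RapidDecay a)
    (hat : ∀ m : (Fin 3 → ℤ), (∑ jj : Fin 3, ((m jj : ℤ) : ℂ) * (a m) jj) = 0) (x : (lp (fun _ : Fin 3 →
        ℤ => EuclideanSpace ℂ (Fin 3)) 2)) (hxt : ∀ k : (Fin 3 → ℤ), (∑ jj : Fin 3, ((k jj : ℤ) : ℂ) * ((x : (Fin 3 →
        ℤ) → (EuclideanSpace ℂ (Fin 3))) k) jj) = 0)
    {F : (Fin 3 → ℤ) → (EuclideanSpace ℂ (Fin 3))} (hF : ∀ s : ℝ, ∑' k, ENNReal.ofReal (sobolevWeight s k) * ‖F k‖ₑ ≠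
        ∞)
    (heq : ∀ k : (Fin 3 → ℤ), (((4 * Real.pi ^ 2 * ν : ℝ)) : ℂ) • (x : (Fin 3 → ℤ) → (EuclideanSpace ℂ (Fin 3))) k +
      Torus.lerayCoeff k ((WithLp.toLp 2 (fun pp : Fin 3 => transportSym (fun jj mm => a mm jj) (fun mm => (((fun mm :
          Fin 3 → ℤ => (((freqNormSq mm)⁻¹ : ℝ) : ℂ)) • ((x : (Fin 3 → ℤ) → (EuclideanSpace ℂ (Fin 3))) : (Fin 3 → ℤ)
          → EuclideanSpace ℂ (Fin 3)))) mm pp) k) : EuclideanSpace ℂ (Fin 3)) + (WithLp.toLp 2 (fun pp : Fin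
          3 => transportSym (fun jj mm => (((fun mm : Fin 3 → ℤ => (((freqNormSq mm)⁻¹ : ℝ) : ℂ)) • ((x : (Fin 3 → ℤ)
          → (EuclideanSpace ℂ (Fin 3))) : (Fin 3 → ℤ) → EuclideanSpace ℂ (Fin 3)))) mm jj) (fun mm => a mm pp) k) :
          EuclideanSpace ℂ (Fin 3))) = F k) :
    RapidDecay (((fun mm : Fin 3 → ℤ => (((freqNormSq mm)⁻¹ : ℝ) : ℂ)) • ((x : (Fin 3 → ℤ) → (EuclideanSpace ℂ (Fin
        3))) : (Fin 3 → ℤ) → EuclideanSpace ℂ (Fin 3)))) := by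
  set A : (Fin 3 → ℤ) → ℝ≥0∞ := fun k => ‖a k‖ₑ + ‖(((fun mm : Fin 3 → ℤ => (((freqNormSq mm)⁻¹ : ℝ) : ℂ)) • ((x :
      (Fin 3 → ℤ) → (EuclideanSpace ℂ (Fin 3))) : (Fin 3 → ℤ) → EuclideanSpace ℂ (Fin 3)))) k‖ₑ with hA
  have hc : 0 < 4 * Real.pi ^ 2 * ν := by positivity
  -- summabilities of the two symbols
  have hsa : Summable fun m => ‖a m‖ := ha.summable_norm
  have hs1 : ∀ k j p, Summable fun m => a m j * (dsym j (k - m) * (((fun mm : Fin 3 → ℤ => (((freqNormSq mm)⁻¹ : ℝ) :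
      ℂ)) • ((x : (Fin 3 → ℤ) → (EuclideanSpace ℂ (Fin 3))) : (Fin 3 → ℤ) → EuclideanSpace ℂ (Fin 3)))) (k - m) p) :=
    fun k j p => summable_nl_term hsa (weight_mul_norm_cf_le_norm x) k j p
  have hs2 : ∀ k j p, Summable fun m => (((fun mm : Fin 3 → ℤ => (((freqNormSq mm)⁻¹ : ℝ) : ℂ)) • ((x : (Fin 3 → ℤ) →
      (EuclideanSpace ℂ (Fin 3))) : (Fin 3 → ℤ) → EuclideanSpace ℂ (Fin 3)))) m j * (dsym j (k - m) * a (k - m) p) :=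
    fun k j p => summable_nl_term (summable_norm_cf x) (weight_mul_norm_le_of_rapidDecay ha) k j p
  -- the convolution bound
  have hconv : ∀ k, ‖Torus.lerayCoeff k ((WithLp.toLp 2 (fun pp : Fin 3 => transportSym (fun jj mm => a mm jj) (fun
      mm => (((fun mm : Fin 3 → ℤ => (((freqNormSq mm)⁻¹ : ℝ) : ℂ)) • ((x : (Fin 3 → ℤ) → (EuclideanSpace ℂ (Fin
      3))) : (Fin 3 → ℤ) → EuclideanSpace ℂ (Fin 3)))) mm pp) k) : EuclideanSpace ℂ (Fin 3)) + (WithLp.toLp 2 (fun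
      pp : Fin 3 => transportSym (fun jj mm => (((fun mm : Fin 3 → ℤ => (((freqNormSq mm)⁻¹ : ℝ) : ℂ)) • ((x : (Fin 3
      → ℤ) → (EuclideanSpace ℂ (Fin 3))) : (Fin 3 → ℤ) → EuclideanSpace ℂ (Fin 3)))) mm jj) (fun mm => a mm pp) k) :
      EuclideanSpace ℂ (Fin 3)))‖ₑ ≤
      2 * (ENNReal.ofReal (18 * Real.pi) * ENNReal.ofReal (sobolevWeight 1 k) * ∑' l, A (k - l) * A l) := by
    intro k
    refine (enorm_lerayCoeff_le k _).trans ((enorm_add_le _ _).trans ?_)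
    rw [two_mul]
    refine add_le_add ?_ ?_
    · refine (enorm_nl_le_of_transversal _ _ k hat (hs1 k)).trans ?_
      refine mul_le_mul_right ?_ _
      calc ∑' m, ‖a m‖ₑ * ‖(((fun mm : Fin 3 → ℤ => (((freqNormSq mm)⁻¹ : ℝ) : ℂ)) • ((x : (Fin 3 → ℤ) →
              (EuclideanSpace ℂ (Fin 3))) : (Fin 3 → ℤ) → EuclideanSpace ℂ (Fin 3)))) (k - m)‖ₑ ≤ ∑' m, A m * A (k -
              m) :=
            ENNReal.tsum_le_tsum fun m => mul_le_mul' le_self_add le_add_self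
        _ = ∑' l, A (k - l) * A l := tsum_congr fun l => mul_comm _ _
    · refine (enorm_nl_le_of_transversal _ _ k (cf_transversal hxt) (hs2 k)).trans ?_
      refine mul_le_mul_right ?_ _
      calc ∑' m, ‖(((fun mm : Fin 3 → ℤ => (((freqNormSq mm)⁻¹ : ℝ) : ℂ)) • ((x : (Fin 3 → ℤ) → (EuclideanSpace ℂ (Fin
              3))) : (Fin 3 → ℤ) → EuclideanSpace ℂ (Fin 3)))) m‖ₑ * ‖a (k - m)‖ₑ ≤ ∑' m, A m * A (k - m) :=
            ENNReal.tsum_le_tsum fun m => mul_le_mul' le_add_self le_self_add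
        _ = ∑' l, A (k - l) * A l := tsum_congr fun l => mul_comm _ _
  -- the rapidly decaying forcing `G k = ⟨k⟩₂ ‖a k‖ + ‖F k‖`
  set C : ℝ≥0∞ := ENNReal.ofReal (1 + 2 * (4 * Real.pi ^ 2 * ν)⁻¹ * (1 + 2 * (18 * Real.pi))) with hC
  have hineq : ∀ k, ENNReal.ofReal (sobolevWeight 2 k) * A k ≤
      C * ((ENNReal.ofReal (sobolevWeight 2 k) * ‖a k‖ₑ + ‖F k‖ₑ) +
        ENNReal.ofReal (sobolevWeight 1 k) * ∑' l, A (k - l) * A l) := by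
    intro k
    have h1 := weight_two_mul_enorm_cf_le (x : (Fin 3 → ℤ) → (EuclideanSpace ℂ (Fin 3))) k
    have h2 := enorm_le_of_smul_add_eq hc (heq k)
    have hi0 : (0 : ℝ) ≤ (4 * Real.pi ^ 2 * ν)⁻¹ := by positivity
    have hC1 : (1 : ℝ≥0∞) ≤ C := ENNReal.one_le_ofReal.2 (by
      have : (0 : ℝ) ≤ 2 * (4 * Real.pi ^ 2 * ν)⁻¹ * (1 + 2 * (18 * Real.pi)) := by positivity
      linarith)
    have hC2 : 2 * ENNReal.ofReal (4 * Real.pi ^ 2 * ν)⁻¹ ≤ C := by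
      have e : 2 * ENNReal.ofReal (4 * Real.pi ^ 2 * ν)⁻¹ = ENNReal.ofReal (2 * (4 * Real.pi ^ 2 * ν)⁻¹) := by
        rw [ENNReal.ofReal_mul (p := 2) (by norm_num), ENNReal.ofReal_ofNat]
      rw [e, hC]
      refine ENNReal.ofReal_le_ofReal ?_
      have : (0 : ℝ) ≤ 2 * (4 * Real.pi ^ 2 * ν)⁻¹ * (2 * (18 * Real.pi)) := by positivity
      nlinarith
    have hC3 : 2 * (ENNReal.ofReal (4 * Real.pi ^ 2 * ν)⁻¹ * (2 * ENNReal.ofReal (18 * Real.pi))) ≤ C := by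
      have e : ENNReal.ofReal (2 * (4 * Real.pi ^ 2 * ν)⁻¹ * (2 * (18 * Real.pi))) =
          2 * (ENNReal.ofReal (4 * Real.pi ^ 2 * ν)⁻¹ * (2 * ENNReal.ofReal (18 * Real.pi))) := by
        rw [ENNReal.ofReal_mul (p := 2 * (4 * Real.pi ^ 2 * ν)⁻¹) (by positivity),
          ENNReal.ofReal_mul (p := 2) (by norm_num), ENNReal.ofReal_mul (p := 2) (by norm_num),
          ENNReal.ofReal_ofNat]
        ring
      rw [← e, hC]
      refine ENNReal.ofReal_le_ofReal ?_
      nlinarith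
    calc ENNReal.ofReal (sobolevWeight 2 k) * A k
        = ENNReal.ofReal (sobolevWeight 2 k) * ‖a k‖ₑ +
            ENNReal.ofReal (sobolevWeight 2 k) * ‖(((fun mm : Fin 3 → ℤ => (((freqNormSq mm)⁻¹ : ℝ) : ℂ)) • ((x : (Fin
                3 → ℤ) → (EuclideanSpace ℂ (Fin 3))) : (Fin 3 → ℤ) → EuclideanSpace ℂ (Fin 3))))
                k‖ₑ := by rw [hA]; ring
      _ ≤ ENNReal.ofReal (sobolevWeight 2 k) * ‖a k‖ₑ + 2 * ‖(x : (Fin 3 → ℤ) → (EuclideanSpace ℂ (Fin 3))) k‖ₑ :=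
          add_le_add le_rfl h1
      _ ≤ ENNReal.ofReal (sobolevWeight 2 k) * ‖a k‖ₑ + 2 * (ENNReal.ofReal (4 * Real.pi ^ 2 * ν)⁻¹ *
            (‖F k‖ₑ + 2 * (ENNReal.ofReal (18 * Real.pi) * ENNReal.ofReal (sobolevWeight 1 k) *
              ∑' l, A (k - l) * A l))) :=
          add_le_add le_rfl (mul_le_mul_right (h2.trans (mul_le_mul_right (add_le_add le_rfl (hconv k)) _)) _)
      _ = 1 * (ENNReal.ofReal (sobolevWeight 2 k) * ‖a k‖ₑ) +
            (2 * ENNReal.ofReal (4 * Real.pi ^ 2 * ν)⁻¹) * ‖F k‖ₑ +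
            (2 * (ENNReal.ofReal (4 * Real.pi ^ 2 * ν)⁻¹ * (2 * ENNReal.ofReal (18 * Real.pi)))) *
            (ENNReal.ofReal (sobolevWeight 1 k) * ∑' l, A (k - l) * A l) := by ring
      _ ≤ C * (ENNReal.ofReal (sobolevWeight 2 k) * ‖a k‖ₑ) + C * ‖F k‖ₑ +
            C * (ENNReal.ofReal (sobolevWeight 1 k) * ∑' l, A (k - l) * A l) :=
          add_le_add (add_le_add (mul_le_mul_left hC1 _) (mul_le_mul_left hC2 _)) (mul_le_mul_left hC3 _)
      _ = C * ((ENNReal.ofReal (sobolevWeight 2 k) * ‖a k‖ₑ + ‖F k‖ₑ) +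
            ENNReal.ofReal (sobolevWeight 1 k) * ∑' l, A (k - l) * A l) := by ring
  have hG : ∀ s : ℝ, ∑' k, ENNReal.ofReal (sobolevWeight s k) *
      (ENNReal.ofReal (sobolevWeight 2 k) * ‖a k‖ₑ + ‖F k‖ₑ) ≠ ∞ := by
    intro s
    have h := tsum_weight_mul_enorm_ne_top_of_rapidDecay ha (s + 2)
    have h1 : ∑' k, ENNReal.ofReal (sobolevWeight s k) * (ENNReal.ofReal (sobolevWeight 2 k) * ‖a k‖ₑ) ≠ ∞ := by
      refine fun htop => h ?_
      rw [← htop]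
      refine tsum_congr fun k => ?_
      rw [← mul_assoc, SteadyNS.ofReal_sobolevWeight_mul]
    have e : ∑' k, ENNReal.ofReal (sobolevWeight s k) * (ENNReal.ofReal (sobolevWeight 2 k) * ‖a k‖ₑ + ‖F k‖ₑ) =
        ∑' k, ENNReal.ofReal (sobolevWeight s k) * (ENNReal.ofReal (sobolevWeight 2 k) * ‖a k‖ₑ) +
          ∑' k, ENNReal.ofReal (sobolevWeight s k) * ‖F k‖ₑ := by
      rw [← ENNReal.tsum_add]
      exact tsum_congr fun k => mul_add _ _ _
    rw [e]
    exact ENNReal.add_ne_top.2 ⟨h1, hF s⟩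
  -- the `H¹` bound for `A`
  have hA2 : ∑' k, ENNReal.ofReal (sobolevWeight 2 k) * A k ^ (2 : ℝ) ≠ ∞ := by
    have hSa : ∑' m, ‖a m‖ₑ ≠ ∞ := by
      have := tsum_weight_mul_enorm_ne_top_of_rapidDecay ha 0
      simpa only [sobolevWeight_zero, ENNReal.ofReal_one, one_mul] using this
    have hWa : ∑' k, ENNReal.ofReal (sobolevWeight 2 k) * ‖a k‖ₑ ≠ ∞ :=
      tsum_weight_mul_enorm_ne_top_of_rapidDecay ha 2
    have hle : ∀ k, ENNReal.ofReal (sobolevWeight 2 k) * A k ^ (2 : ℝ) ≤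
        2 * ((∑' m, ‖a m‖ₑ) * (ENNReal.ofReal (sobolevWeight 2 k) * ‖a k‖ₑ)) +
        2 * (ENNReal.ofReal (sobolevWeight 2 k) * ‖(((fun mm : Fin 3 → ℤ => (((freqNormSq mm)⁻¹ : ℝ) : ℂ)) • ((x :
            (Fin 3 → ℤ) → (EuclideanSpace ℂ (Fin 3))) : (Fin 3 → ℤ) → EuclideanSpace ℂ (Fin 3)))) k‖ₑ ^ (2 : ℝ)) := by
      intro k
      rw [ENNReal.rpow_two, ENNReal.rpow_two]
      have hak : ‖a k‖ₑ ≤ ∑' m, ‖a m‖ₑ := ENNReal.le_tsum k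
      calc ENNReal.ofReal (sobolevWeight 2 k) * A k ^ 2
          ≤ ENNReal.ofReal (sobolevWeight 2 k) * (2 * ‖a k‖ₑ ^ 2 + 2 * ‖(((fun mm : Fin 3 → ℤ => (((freqNormSq mm)⁻¹ :
              ℝ) : ℂ)) • ((x : (Fin 3 → ℤ) → (EuclideanSpace ℂ (Fin 3))) : (Fin 3 → ℤ) → EuclideanSpace ℂ (Fin 3))))
              k‖ₑ ^ 2) :=
            mul_le_mul_right (Lattice.ennreal_add_pow_two_le _ _) _
        _ = 2 * (‖a k‖ₑ * (ENNReal.ofReal (sobolevWeight 2 k) * ‖a k‖ₑ)) +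
            2 * (ENNReal.ofReal (sobolevWeight 2 k) * ‖(((fun mm : Fin 3 → ℤ => (((freqNormSq mm)⁻¹ : ℝ) : ℂ)) • ((x :
                (Fin 3 → ℤ) → (EuclideanSpace ℂ (Fin 3))) : (Fin 3 → ℤ) → EuclideanSpace ℂ (Fin 3)))) k‖ₑ ^
                2) := by ring
        _ ≤ _ := add_le_add (mul_le_mul_right (mul_le_mul_left hak _) _) le_rfl
    refine ne_top_of_le_ne_top ?_ (ENNReal.tsum_le_tsum hle)
    rw [ENNReal.tsum_add, ENNReal.tsum_mul_left, ENNReal.tsum_mul_left, ENNReal.tsum_mul_left]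
    exact ENNReal.add_ne_top.2 ⟨ENNReal.mul_ne_top (by simp) (ENNReal.mul_ne_top hSa hWa),
      ENNReal.mul_ne_top (by simp) (tsum_weight_two_mul_enorm_cf_sq_ne_top x)⟩
  have hCtop : C ≠ ∞ := ENNReal.ofReal_ne_top
  have hfin := SteadyNS.tsum_weight_mul_ne_top (A := A)
    (F := fun k => ENNReal.ofReal (sobolevWeight 2 k) * ‖a k‖ₑ + ‖F k‖ₑ) hCtop hG hineq (by simp) hA2
  refine SteadyNS.rapidDecay_of_tsum_weight_mul_enorm_ne_top fun m => ?_
  exact ne_top_of_le_ne_top (hfin m) (ENNReal.tsum_le_tsum fun k => mul_le_mul_right le_add_self _)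

end Regularity

/-! ## §B From a rapidly decaying lattice solution to the classical resolvent relation `L(ν,u₀) w = g` -/

section Classical

/-- **From a rapidly decaying solution of the projected linearised lattice equation with right-hand
side to a classical solution of `L(ν,u₀) w = g`, with its Fourier coefficients**: for smooth
divergence-free `u₀`, smooth `g` with `ĝ(0) = 0`, and a rapidly decaying transversal `c` with `c 0 = 0`
solving `ν4π²|k|² c(k) + Π_k (N(û₀, c) + N(c, û₀))(k) = −Π_k ĝ(k)`, the Fourier synthesis `w` of `c`
is smooth, divergence free, mean zero and solves `νΔw − (u₀·∇)w − (w·∇)u₀ − ∇q = g` for the smooth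
pressure with symbol `−(k·(M(k) + ĝ(k)))/(2πi|k|²)`, `M = N(û₀, c) + N(c, û₀)`; and `𝓕 w = c`.
(adapted from `SteadyLattice.isLinNSEigenvalue_of_fourier`, the case `g = 0`.) [folklore] -/
theorem linNSResolventRel_of_fourier {ν : ℝ} {u₀ : (UnitAddTorus (Fin 3)) → (EuclideanSpace ℝ (Fin 3))} (hu₀ :
    IsSmooth u₀) (hdiv₀ : IsDivFree u₀)
    {g : (UnitAddTorus (Fin 3)) → (EuclideanSpace ℂ (Fin 3))} (hg : IsSmooth g) (hg0 : mFourierCoeff g 0 = 0)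
    {c : (Fin 3 → ℤ) → (EuclideanSpace ℂ (Fin 3))} (hc : RapidDecay c) (hct : ∀ k : (Fin 3 → ℤ), (∑ jj : Fin 3, ((k
        jj : ℤ) : ℂ) * (c k) jj) = 0) (hc0 : c 0 = 0)
    (heq : ∀ k : (Fin 3 → ℤ), (((ν * (4 * Real.pi ^ 2 * freqNormSq k)) : ℝ) : ℂ) • c k +
      Torus.lerayCoeff k ((WithLp.toLp 2 (fun pp : Fin 3 => transportSym (fun jj mm => (mFourierCoeff (complexify
          ∘ u₀)) mm jj) (fun mm => c mm pp) k) : EuclideanSpace ℂ (Fin 3)) + (WithLp.toLp 2 (fun pp : Fin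
          3 => transportSym (fun jj mm => c mm jj) (fun mm => (mFourierCoeff (complexify ∘ u₀)) mm pp) k) :
          EuclideanSpace ℂ (Fin 3))) =
      -Torus.lerayCoeff k (mFourierCoeff g k)) :
    ∃ w : (UnitAddTorus (Fin 3)) → (EuclideanSpace ℂ (Fin 3)), Torus.LinNSResolventRel ν u₀ 0 w g ∧ mFourierCoeff w =
        c := by
  set a : (Fin 3 → ℤ) → (EuclideanSpace ℂ (Fin 3)) := mFourierCoeff (complexify ∘ u₀) with ha
  have har : RapidDecay a := hu₀.complexify_comp.rapidDecay_mFourierCoeff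
  have hat : ∀ m : (Fin 3 → ℤ), (∑ jj : Fin 3, ((m jj : ℤ) : ℂ) * (a m) jj) = 0 :=
      fun m => hdiv₀.sum_mul_mFourierCoeff_eq_zero hu₀ m
  set G : (Fin 3 → ℤ) → (EuclideanSpace ℂ (Fin 3)) := mFourierCoeff g with hGdef
  have hGr : RapidDecay G := hg.rapidDecay_mFourierCoeff
  -- the velocity
  set w : (UnitAddTorus (Fin 3)) → (EuclideanSpace ℂ (Fin 3)) := fourierSynth c with hwdef
  have hw : IsSmooth w := hc.isSmooth_fourierSynth
  have hŵ : mFourierCoeff w = c := funext hc.mFourierCoeff_fourierSynth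
  -- the linearised convective symbol is the coefficient family of a smooth field
  have hM : ∀ k, mFourierCoeff (Torus.convect u₀ w) k + mFourierCoeff (Torus.stretch w u₀) k = (WithLp.toLp 2 (fun
      pp : Fin 3 => transportSym (fun jj mm => a mm jj) (fun mm => c mm pp) k) : EuclideanSpace ℂ (Fin 3)) +
      (WithLp.toLp 2 (fun pp : Fin 3 => transportSym (fun jj mm => c mm jj) (fun mm => a mm pp) k) : EuclideanSpace ℂ
      (Fin 3)) := by
    intro k
    rw [mFourierCoeff_convect_complex hu₀ hw k, mFourierCoeff_stretch hu₀ hw k, hŵ]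
  have hMr : RapidDecay (fun k => (WithLp.toLp 2 (fun pp : Fin 3 => transportSym (fun jj mm => a mm jj) (fun mm => c
      mm pp) k) : EuclideanSpace ℂ (Fin 3)) + (WithLp.toLp 2 (fun pp : Fin 3 => transportSym (fun jj mm => c mm jj)
      (fun mm => a mm pp) k) : EuclideanSpace ℂ (Fin 3))) := by
    have h := ((hu₀.convect hw).rapidDecay_mFourierCoeff).add ((isSmooth_stretch hu₀ hw).rapidDecay_mFourierCoeff)
    have e : mFourierCoeff (Torus.convect u₀ w) + mFourierCoeff (Torus.stretch w u₀) = fun k => (WithLp.toLp 2 (fun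
        pp : Fin 3 => transportSym (fun jj mm => a mm jj) (fun mm => c mm pp) k) : EuclideanSpace ℂ (Fin 3)) +
        (WithLp.toLp 2 (fun pp : Fin 3 => transportSym (fun jj mm => c mm jj) (fun mm => a mm pp) k) : EuclideanSpace
        ℂ (Fin 3)) :=
      funext hM
    rwa [e] at h
  have hM0 : (WithLp.toLp 2 (fun pp : Fin 3 => transportSym (fun jj mm => a mm jj) (fun mm => c mm pp) 0) :
      EuclideanSpace ℂ (Fin 3)) + (WithLp.toLp 2 (fun pp : Fin 3 => transportSym (fun jj mm => c mm jj) (fun mm => a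
      mm pp) 0) : EuclideanSpace ℂ (Fin 3)) = 0 := by
    rw [nl_zero_of_transversal a c hat (fun j p => summable_nl_rapid har hc 0 j p),
      nl_zero_of_transversal c a hct (fun j p => summable_nl_rapid hc har 0 j p), add_zero]
  -- the pressure
  set qh : (Fin 3 → ℤ) → ℂ := fun k => (∑ jj : Fin 3, ((k jj : ℤ) : ℂ) * (-((WithLp.toLp 2 (fun pp : Fin
      3 => transportSym (fun jj mm => a mm jj) (fun mm => c mm pp) k) : EuclideanSpace ℂ (Fin 3)) + (WithLp.toLp 2
      (fun pp : Fin 3 => transportSym (fun jj mm => c mm jj) (fun mm => a mm pp) k) : EuclideanSpace ℂ (Fin 3)) + G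
      k)) jj) / (2 * Real.pi * Complex.I * ((freqNormSq k : ℝ) : ℂ))
    with hqh
  have hqhr : RapidDecay qh := by
    have hg' : RapidDecay (fun k => -((WithLp.toLp 2 (fun pp : Fin 3 => transportSym (fun jj mm => a mm jj) (fun
        mm => c mm pp) k) : EuclideanSpace ℂ (Fin 3)) + (WithLp.toLp 2 (fun pp : Fin 3 => transportSym (fun jj mm => c
        mm jj) (fun mm => a mm pp) k) : EuclideanSpace ℂ (Fin 3)) + G k)) := by
      have := (hMr.add hGr).const_smul (-1)
      convert this using 1
      funext k
      simp only [Pi.smul_apply, Pi.add_apply, neg_one_smul]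
    exact rapidDecay_pressureSymbol hg'
  set q : (UnitAddTorus (Fin 3)) → ℂ := fourierSynth qh with hq
  have hqs : IsSmooth q := hqhr.isSmooth_fourierSynth
  have hqc : ∀ k, mFourierCoeff q k = qh k := hqhr.mFourierCoeff_fourierSynth
  -- the residual `L w − g`
  have c4 : Continuous fun y => Torus.gradientC q y :=
    (PiLp.continuous_toLp 2 _).comp (continuous_pi fun l => (hqs.partialDeriv l).continuous)
  have hEc : Continuous (fun y => Torus.linearizedNSOperator ν u₀ w q y - g y) := by
    have c1 : Continuous fun y => laplacian w y := hw.laplacian.continuous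
    have c2 : Continuous (Torus.convect u₀ w) := (hu₀.convect hw).continuous
    have c3 : Continuous (Torus.stretch w u₀) := (isSmooth_stretch hu₀ hw).continuous
    simp only [Torus.linearizedNSOperator_apply]
    exact (((c1.const_smul ν).sub (c2.add c3)).sub c4).sub hg.continuous
  have hEcoeff : ∀ k, mFourierCoeff (fun y => Torus.linearizedNSOperator ν u₀ w q y - g y) k = 0 := by
    intro k
    have i1 : Integrable (fun y => laplacian w y) volume := hw.laplacian.integrable
    have i1' : Integrable ((ν : ℂ) • fun y => laplacian w y) volume := i1.smul (ν : ℂ)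
    have i2 : Integrable (Torus.convect u₀ w) volume := (hu₀.convect hw).integrable
    have i3 : Integrable (Torus.stretch w u₀) volume := (isSmooth_stretch hu₀ hw).integrable
    have i4 : Integrable (Torus.gradientC q) volume := c4.integrable_unitAddTorus
    have i5 : Integrable g volume := hg.integrable
    have hfun : (fun y => Torus.linearizedNSOperator ν u₀ w q y - g y) =
        ((ν : ℂ) • fun y => laplacian w y) - (Torus.convect u₀ w + Torus.stretch w u₀) - Torus.gradientC q - g := by
      funext y
      simp only [Torus.linearizedNSOperator_apply, Pi.sub_apply, Pi.add_apply, Pi.smul_apply, Complex.coe_smul]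
    rw [hfun, mFourierCoeff_sub ((i1'.sub (i2.add i3)).sub i4) i5, mFourierCoeff_sub (i1'.sub (i2.add i3)) i4,
      mFourierCoeff_sub i1' (i2.add i3), mFourierCoeff_add i2 i3,
      mFourierCoeff_const_smul, hM k, mFourierCoeff_gradientC hqs k, hqc k,
      show (fun y => laplacian w y) = laplacian w from rfl, Torus.mFourierCoeff_laplacian hw k, hŵ, ← hGdef]
    by_cases hk : k = 0
    · subst hk
      rw [hM0, freqNormSq_zero, Torus.freqVec_zero, smul_zero, hc0]
      have hG0 : G 0 = 0 := hg0
      rw [hG0]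
      simp
    · have h1 := heq k
      have hq' : ((freqNormSq k : ℝ) : ℂ) ≠ 0 := by
        exact_mod_cast (ne_of_gt (lt_of_lt_of_le one_pos (one_le_freqNormSq' hk)))
      have hI : (2 * Real.pi * Complex.I : ℂ) ≠ 0 :=
        mul_ne_zero (mul_ne_zero two_ne_zero (by exact_mod_cast Real.pi_ne_zero)) Complex.I_ne_zero
      have hsplit := sub_lerayCoeff hk ((WithLp.toLp 2 (fun pp : Fin 3 => transportSym (fun jj mm => a mm jj) (fun
          mm => c mm pp) k) : EuclideanSpace ℂ (Fin 3)) + (WithLp.toLp 2 (fun pp : Fin 3 => transportSym (fun jj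
          mm => c mm jj) (fun mm => a mm pp) k) : EuclideanSpace ℂ (Fin 3)) + G k)
      have hcoef : 2 * Real.pi * Complex.I * qh k =
          -((∑ jj : Fin 3, ((k jj : ℤ) : ℂ) * ((WithLp.toLp 2 (fun pp : Fin 3 => transportSym (fun jj mm => a mm jj)
              (fun mm => c mm pp) k) : EuclideanSpace ℂ (Fin 3)) + (WithLp.toLp 2 (fun pp : Fin 3 => transportSym (fun
              jj mm => c mm jj) (fun mm => a mm pp) k) : EuclideanSpace ℂ (Fin 3)) + G k) jj) / ((freqNormSq k : ℝ) :
              ℂ)) := by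
        have e : qh k = -((∑ jj : Fin 3, ((k jj : ℤ) : ℂ) * ((WithLp.toLp 2 (fun pp : Fin 3 => transportSym (fun jj
            mm => a mm jj) (fun mm => c mm pp) k) : EuclideanSpace ℂ (Fin 3)) + (WithLp.toLp 2 (fun pp : Fin
            3 => transportSym (fun jj mm => c mm jj) (fun mm => a mm pp) k) : EuclideanSpace ℂ (Fin 3)) + G k) jj)) /
            (2 * Real.pi * Complex.I * ((freqNormSq k : ℝ) : ℂ)) := by
          rw [hqh]
          dsimp only
          rw [show -((WithLp.toLp 2 (fun pp : Fin 3 => transportSym (fun jj mm => a mm jj) (fun mm => c mm pp) k) :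
              EuclideanSpace ℂ (Fin 3)) + (WithLp.toLp 2 (fun pp : Fin 3 => transportSym (fun jj mm => c mm jj) (fun
              mm => a mm pp) k) : EuclideanSpace ℂ (Fin 3)) + G k) = (0 : (EuclideanSpace ℂ (Fin 3))) - ((WithLp.toLp
              2 (fun pp : Fin 3 => transportSym (fun jj mm => a mm jj) (fun mm => c mm pp) k) : EuclideanSpace ℂ (Fin
              3)) + (WithLp.toLp 2 (fun pp : Fin 3 => transportSym (fun jj mm => c mm jj) (fun mm => a mm pp) k) :
              EuclideanSpace ℂ (Fin 3)) + G k) from (zero_sub _).symm,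
            kdot_sub', kdot_zero, zero_sub]
        rw [e]
        field_simp
      rw [hcoef, neg_smul]
      have e3 : (ν : ℂ) • -((((4 * Real.pi ^ 2 * freqNormSq k : ℝ)) : ℂ) • c k) =
          Torus.lerayCoeff k ((WithLp.toLp 2 (fun pp : Fin 3 => transportSym (fun jj mm => a mm jj) (fun mm => c mm
              pp) k) : EuclideanSpace ℂ (Fin 3)) + (WithLp.toLp 2 (fun pp : Fin 3 => transportSym (fun jj mm => c mm
              jj) (fun mm => a mm pp) k) : EuclideanSpace ℂ (Fin 3)) + G k) := by
        rw [smul_neg, smul_smul, ← Complex.ofReal_mul, lerayCoeff_add', eq_sub_of_add_eq h1]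
        abel
      rw [e3]
      linear_combination (norm := module) -hsplit
  have hE0 : (fun y => Torus.linearizedNSOperator ν u₀ w q y - g y) = 0 :=
    eq_zero_of_forall_mFourierCoeff_eq_zero hEc hEcoeff
  -- divergence
  have hdivC : Torus.IsDivFreeC w := by
    intro y
    set D : (UnitAddTorus (Fin 3)) → ℂ := fun z => ∑ l, Torus.partialDeriv l (fun x => w x l) z with hD
    have hwl : ∀ l, IsSmooth (fun x => w x l) := fun l =>
      hw.comp_clm ((EuclideanSpace.proj l : (EuclideanSpace ℂ (Fin 3)) →L[ℂ] ℂ).restrictScalars ℝ)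
    have hDc : Continuous D := continuous_finsetSum _ fun l _ => ((hwl l).partialDeriv l).continuous
    have hDcoeff : ∀ k, mFourierCoeff D k = 0 := by
      intro k
      rw [hD, mFourierCoeff_finset_sum (f := fun l => Torus.partialDeriv l (fun x => w x l)) _
        (fun l _ => ((hwl l).partialDeriv l).integrable)]
      have h2 : ∀ l, mFourierCoeff (Torus.partialDeriv l (fun x => w x l)) k = dsym l k * c k l := fun l => by
        rw [mFourierCoeff_partialDeriv (hwl l) l k, coeff_apply_complex hw k l, hŵ, dsym_apply, smul_eq_mul]
      simp only [h2, dsym_apply]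
      calc ∑ l, 2 * ↑Real.pi * Complex.I * (((k l : ℤ) : ℂ)) * c k l
          = 2 * ↑Real.pi * Complex.I * (∑ jj : Fin 3, ((k jj : ℤ) : ℂ) * (c k) jj) := by
            rw [Finset.mul_sum]; exact Finset.sum_congr rfl fun l _ => by ring
        _ = 0 := by rw [hct k, mul_zero]
    have hD0 : D = 0 := eq_zero_of_forall_mFourierCoeff_eq_zero hDc hDcoeff
    have hy := congrFun hD0 y
    simpa only [hD, Pi.zero_apply, Torus.divergenceC] using hy
  -- zero mean
  have hmean : HasZeroMean w := hasZeroMean_of_mFourierCoeff_zero (by rw [hŵ]; exact hc0)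
  refine ⟨w, ⟨hw, hdivC, hmean, q, hqs, fun y => ?_⟩, hŵ⟩
  have hy := congrFun hE0 y
  simp only [Pi.zero_apply] at hy
  rw [zero_smul, sub_zero]
  exact sub_eq_zero.1 hy

end Classical

/-! ## §C Packaged forms for square-summable unknowns, and the directional-derivative (Goldstone) vector -/

section Packaged

/-- **The inhomogeneous linearised lattice equation for `x ∈ ℓ²`, solved classically**: if `x ∈ ℓ²`
(zero mode `0`, transversal) solves `4π²ν x(k) + Π_k (N(û₀, x̌) + N(x̌, û₀))(k) = −Π_k ĝ(k)` for a
smooth divergence-free `u₀` and a smooth `g` with `ĝ(0) = 0`, then `x̌ = 𝓕 w` for a classical solution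
`w` of `L(ν,u₀) w = g` (`rapidDecay_of_linearised_eq_rhs` + `linNSResolventRel_of_fourier`). [folklore] -/
theorem exists_linNSResolventRel_of_latticeEq {ν : ℝ} (hν : 0 < ν) {u₀ : (UnitAddTorus (Fin 3)) → (EuclideanSpace ℝ
    (Fin 3))} (hu₀ : IsSmooth u₀)
    (hdiv₀ : IsDivFree u₀) {g : (UnitAddTorus (Fin 3)) → (EuclideanSpace ℂ (Fin 3))} (hg : IsSmooth g) (hg0 :
        mFourierCoeff g 0 = 0)
    (x : (lp (fun _ : Fin 3 → ℤ => EuclideanSpace ℂ (Fin 3)) 2)) (hx0 : (x : (Fin 3 → ℤ) → (EuclideanSpace ℂ (Fin 3)))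
        0 = 0) (hxt : ∀ k : (Fin 3 → ℤ), (∑ jj : Fin 3, ((k jj : ℤ) : ℂ) * ((x : (Fin 3 → ℤ) → (EuclideanSpace ℂ (Fin
        3))) k) jj) = 0)
    (heq : ∀ k : (Fin 3 → ℤ), (((4 * Real.pi ^ 2 * ν : ℝ)) : ℂ) • (x : (Fin 3 → ℤ) → (EuclideanSpace ℂ (Fin 3))) k +
      Torus.lerayCoeff k ((WithLp.toLp 2 (fun pp : Fin 3 => transportSym (fun jj mm => (mFourierCoeff (complexify
          ∘ u₀)) mm jj) (fun mm => (((fun mm : Fin 3 → ℤ => (((freqNormSq mm)⁻¹ : ℝ) : ℂ)) • ((x : (Fin 3 → ℤ) →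
          (EuclideanSpace ℂ (Fin 3))) : (Fin 3 → ℤ) → EuclideanSpace ℂ (Fin 3)))) mm pp) k) : EuclideanSpace ℂ (Fin
          3)) +
        (WithLp.toLp 2 (fun pp : Fin 3 => transportSym (fun jj mm => (((fun mm : Fin 3 → ℤ => (((freqNormSq mm)⁻¹ :
            ℝ) : ℂ)) • ((x : (Fin 3 → ℤ) → (EuclideanSpace ℂ (Fin 3))) : (Fin 3 → ℤ) → EuclideanSpace ℂ (Fin 3)))) mm
            jj) (fun mm => (mFourierCoeff (complexify ∘ u₀)) mm pp) k) : EuclideanSpace ℂ (Fin 3))) =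
            -Torus.lerayCoeff k (mFourierCoeff g k)) :
    ∃ w : (UnitAddTorus (Fin 3)) → (EuclideanSpace ℂ (Fin 3)), Torus.LinNSResolventRel ν u₀ 0 w g ∧ mFourierCoeff w =
        ((fun mm : Fin 3 → ℤ => (((freqNormSq mm)⁻¹ : ℝ) : ℂ)) • ((x : (Fin 3 → ℤ) → (EuclideanSpace ℂ (Fin 3))) :
        (Fin 3 → ℤ) → EuclideanSpace ℂ (Fin 3))) := by
  have har : RapidDecay (mFourierCoeff (complexify ∘ u₀)) := hu₀.complexify_comp.rapidDecay_mFourierCoeff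
  have hat : ∀ m : (Fin 3 → ℤ), (∑ jj : Fin 3, ((m jj : ℤ) : ℂ) * (mFourierCoeff (complexify ∘ u₀) m) jj) = 0 :=
      fun m =>
    hdiv₀.sum_mul_mFourierCoeff_eq_zero hu₀ m
  have hGr : RapidDecay (mFourierCoeff g) := hg.rapidDecay_mFourierCoeff
  have hF : ∀ s : ℝ, ∑' k, ENNReal.ofReal (sobolevWeight s k) * ‖-Torus.lerayCoeff k (mFourierCoeff g k)‖ₑ ≠ ∞ := by
    intro s
    refine ne_top_of_le_ne_top (tsum_weight_mul_enorm_ne_top_of_rapidDecay hGr s)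
      (ENNReal.tsum_le_tsum fun k => ?_)
    rw [enorm_neg]
    exact mul_le_mul_right (enorm_lerayCoeff_le k _) _
  have hxr : RapidDecay (((fun mm : Fin 3 → ℤ => (((freqNormSq mm)⁻¹ : ℝ) : ℂ)) • ((x : (Fin 3 → ℤ) → (EuclideanSpace
      ℂ (Fin 3))) : (Fin 3 → ℤ) → EuclideanSpace ℂ (Fin 3)))) := rapidDecay_of_linearised_eq_rhs hν har hat x hxt hF
      heq
  have heq' : ∀ k : (Fin 3 → ℤ), (((ν * (4 * Real.pi ^ 2 * freqNormSq k)) : ℝ) : ℂ) • (((fun mm : Fin 3 →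
      ℤ => (((freqNormSq mm)⁻¹ : ℝ) : ℂ)) • ((x : (Fin 3 → ℤ) → (EuclideanSpace ℂ (Fin 3))) : (Fin 3 → ℤ) →
      EuclideanSpace ℂ (Fin 3)))) k +
      Torus.lerayCoeff k ((WithLp.toLp 2 (fun pp : Fin 3 => transportSym (fun jj mm => (mFourierCoeff (complexify
          ∘ u₀)) mm jj) (fun mm => (((fun mm : Fin 3 → ℤ => (((freqNormSq mm)⁻¹ : ℝ) : ℂ)) • ((x : (Fin 3 → ℤ) →
          (EuclideanSpace ℂ (Fin 3))) : (Fin 3 → ℤ) → EuclideanSpace ℂ (Fin 3)))) mm pp) k) : EuclideanSpace ℂ (Fin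
          3)) +
        (WithLp.toLp 2 (fun pp : Fin 3 => transportSym (fun jj mm => (((fun mm : Fin 3 → ℤ => (((freqNormSq mm)⁻¹ :
            ℝ) : ℂ)) • ((x : (Fin 3 → ℤ) → (EuclideanSpace ℂ (Fin 3))) : (Fin 3 → ℤ) → EuclideanSpace ℂ (Fin 3)))) mm
            jj) (fun mm => (mFourierCoeff (complexify ∘ u₀)) mm pp) k) : EuclideanSpace ℂ (Fin 3))) =
            -Torus.lerayCoeff k (mFourierCoeff g k) :=
    fun k => by rw [← smul_eq_weight_smul_cf hx0 k]; exact heq k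
  exact linNSResolventRel_of_fourier hu₀ hdiv₀ hg hg0 hxr (cf_transversal hxt) (cf_zero _) heq'

/-- **The steady lattice equation for `x ∈ ℓ²`, solved classically**: if `x ∈ ℓ²` (zero mode `0`,
transversal, conjugate symmetric) solves `4π²ν x(k) + Π_k N(x̌, x̌)(k) = f̂(k)` for a smooth
divergence-free mean-zero real force `f`, then `x̌ = 𝓕 u` for a mean-zero classical steady state `u`
of `NS_ν(f)` (`rapidDecay_of_steady_eq` + `steadyState_of_fourier`). [folklore] -/
theorem exists_steadyState_of_latticeEq {ν : ℝ} (hν : 0 < ν) {f : (UnitAddTorus (Fin 3)) → (EuclideanSpace ℝ (Fin 3))}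
    (hf : IsSmooth f)
    (hfd : IsDivFree f) (hf0 : HasZeroMean f) (x : (lp (fun _ : Fin 3 → ℤ => EuclideanSpace ℂ (Fin 3)) 2)) (hx0 : (x :
        (Fin 3 → ℤ) → (EuclideanSpace ℂ (Fin 3))) 0 = 0)
    (hxt : ∀ k : (Fin 3 → ℤ), (∑ jj : Fin 3, ((k jj : ℤ) : ℂ) * ((x : (Fin 3 → ℤ) → (EuclideanSpace ℂ (Fin 3))) k) jj)
        = 0) (hxc : IsConjSymm (x : (Fin 3 → ℤ) → (EuclideanSpace ℂ (Fin 3))))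
    (heq : ∀ k : (Fin 3 → ℤ), (((4 * Real.pi ^ 2 * ν : ℝ)) : ℂ) • (x : (Fin 3 → ℤ) → (EuclideanSpace ℂ (Fin 3))) k +
      Torus.lerayCoeff k ((WithLp.toLp 2 (fun pp : Fin 3 => transportSym (fun jj mm => (((fun mm : Fin 3 →
          ℤ => (((freqNormSq mm)⁻¹ : ℝ) : ℂ)) • ((x : (Fin 3 → ℤ) → (EuclideanSpace ℂ (Fin 3))) : (Fin 3 → ℤ) →
          EuclideanSpace ℂ (Fin 3)))) mm jj) (fun mm => (((fun mm : Fin 3 → ℤ => (((freqNormSq mm)⁻¹ : ℝ) : ℂ)) •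
          ((x : (Fin 3 → ℤ) → (EuclideanSpace ℂ (Fin 3))) : (Fin 3 → ℤ) → EuclideanSpace ℂ (Fin 3)))) mm pp) k) :
          EuclideanSpace ℂ (Fin 3))) = mFourierCoeff (complexify ∘ f) k) :
    ∃ (u : (UnitAddTorus (Fin 3)) → (EuclideanSpace ℝ (Fin 3))) (p : (UnitAddTorus (Fin 3)) → ℝ),
        Torus.IsSteadyNSState ν f u p ∧ HasZeroMean u ∧ IsSmooth u ∧
      mFourierCoeff (complexify ∘ u) = ((fun mm : Fin 3 → ℤ => (((freqNormSq mm)⁻¹ : ℝ) : ℂ)) • ((x : (Fin 3 → ℤ) →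
          (EuclideanSpace ℂ (Fin 3))) : (Fin 3 → ℤ) → EuclideanSpace ℂ (Fin 3))) := by
  have hxr : RapidDecay (((fun mm : Fin 3 → ℤ => (((freqNormSq mm)⁻¹ : ℝ) : ℂ)) • ((x : (Fin 3 → ℤ) → (EuclideanSpace
      ℂ (Fin 3))) : (Fin 3 → ℤ) → EuclideanSpace ℂ (Fin 3)))) :=
    rapidDecay_of_steady_eq hν x hxt (tsum_weight_mul_enorm_ne_top_of_rapidDecay
      (hf.complexify_comp.rapidDecay_mFourierCoeff)) heq
  have heq' : ∀ k : (Fin 3 → ℤ), (((ν * (4 * Real.pi ^ 2 * freqNormSq k)) : ℝ) : ℂ) • (((fun mm : Fin 3 →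
      ℤ => (((freqNormSq mm)⁻¹ : ℝ) : ℂ)) • ((x : (Fin 3 → ℤ) → (EuclideanSpace ℂ (Fin 3))) : (Fin 3 → ℤ) →
      EuclideanSpace ℂ (Fin 3)))) k +
      Torus.lerayCoeff k ((WithLp.toLp 2 (fun pp : Fin 3 => transportSym (fun jj mm => (((fun mm : Fin 3 →
          ℤ => (((freqNormSq mm)⁻¹ : ℝ) : ℂ)) • ((x : (Fin 3 → ℤ) → (EuclideanSpace ℂ (Fin 3))) : (Fin 3 → ℤ) →
          EuclideanSpace ℂ (Fin 3)))) mm jj) (fun mm => (((fun mm : Fin 3 → ℤ => (((freqNormSq mm)⁻¹ : ℝ) : ℂ)) •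
          ((x : (Fin 3 → ℤ) → (EuclideanSpace ℂ (Fin 3))) : (Fin 3 → ℤ) → EuclideanSpace ℂ (Fin 3)))) mm pp) k) :
          EuclideanSpace ℂ (Fin 3))) = mFourierCoeff (complexify ∘ f) k :=
    fun k => by rw [← smul_eq_weight_smul_cf hx0 k]; exact heq k
  exact steadyState_of_fourier hf hfd hf0 hxr (isConjSymm_cf hxc) (cf_transversal hxt) (cf_zero _) heq'

/-- Families vanishing at the zero mode are determined by their `cf`-images. [folklore] -/
theorem eq_of_cf_eq {x y : (Fin 3 → ℤ) → (EuclideanSpace ℂ (Fin 3))} (hx0 : x 0 = 0) (hy0 : y 0 = 0) (h : ((fun mm :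
    Fin 3 → ℤ => (((freqNormSq mm)⁻¹ : ℝ) : ℂ)) • (x : (Fin 3 → ℤ) → EuclideanSpace ℂ (Fin 3))) = ((fun mm : Fin 3 →
    ℤ => (((freqNormSq mm)⁻¹ : ℝ) : ℂ)) • (y : (Fin 3 → ℤ) → EuclideanSpace ℂ (Fin 3)))) : x = y := by
  funext k
  by_cases hk : k = 0
  · subst hk; rw [hx0, hy0]
  · have hf : ((((freqNormSq k)⁻¹ : ℝ)) : ℂ) ≠ 0 := by
      exact_mod_cast inv_ne_zero (ne_of_gt (lt_of_lt_of_le one_pos (one_le_freqNormSq' hk)))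
    have hk' := congrFun h k
    rw [cf_apply, cf_apply] at hk'
    exact smul_right_injective _ hf hk'

/-- **Reality of a complex multiple**: if `c = z • V` for two conjugate-symmetric families, then
already `c = (Re z) • V` (at each mode either `V k = 0` or `z` is real). [folklore] -/
theorem eq_re_smul_of_isConjSymm {c V : (Fin 3 → ℤ) → (EuclideanSpace ℂ (Fin 3))} (hc : IsConjSymm c) (hV : IsConjSymm
    V) {z : ℂ}
    (h : ∀ k, c k = z • V k) : ∀ k, c k = ((z.re : ℝ) : ℂ) • V k := by
  intro k
  have h1 : conjVec (c k) = z • conjVec (V k) := by rw [← hc k, h (-k), hV k]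
  rw [h k, conjVec_smul] at h1
  -- `(conj z − z) • conjVec (V k) = 0`
  have h2 : (starRingEnd ℂ z - z) • conjVec (V k) = 0 := by rw [sub_smul, h1, sub_self]
  rcases smul_eq_zero.1 h2 with h3 | h3
  · have hz : z = ((z.re : ℝ) : ℂ) := by
      apply Complex.ext
      · simp
      · have := congrArg Complex.im (sub_eq_zero.1 h3)
        simp only [Complex.conj_im] at this
        simp only [Complex.ofReal_im]
        linarith
    rw [h k, ← hz]
  · have hV0 : V k = 0 := by
      have := congrArg conjVec h3
      rwa [conjVec_conjVec, conjVec_zero] at this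
    rw [h k, hV0, smul_zero, smul_zero]

/-- **Fourier coefficients of a lattice directional derivative**:
`𝓕(∑ᵢ dirᵢ ∂ᵢu)(k) = (2πi (k·dir)) û(k)`. [folklore] -/
theorem mFourierCoeff_dirDeriv {u : (UnitAddTorus (Fin 3)) → (EuclideanSpace ℝ (Fin 3))} (hu : IsSmooth u) (dir : Fin
    3 → ℤ) (k : (Fin 3 → ℤ)) :
    mFourierCoeff (complexify ∘ fun y => ∑ i, (dir i : ℝ) • Torus.partialDeriv i u y) k =
      (2 * Real.pi * Complex.I * (∑ i, ((k i : ℤ) : ℂ) * ((dir i : ℤ) : ℂ))) • mFourierCoeff (complexify ∘ u) k := by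
  have hterm : ∀ i, IsSmooth (fun y => ((dir i : ℝ) : ℂ) • Torus.partialDeriv i (complexify ∘ u) y) := fun i =>
    ((hu.complexify_comp).partialDeriv i).const_smul _
  have e : (complexify ∘ fun y => ∑ i, (dir i : ℝ) • Torus.partialDeriv i u y) =
      fun y => ∑ i, (fun z => ((dir i : ℝ) : ℂ) • Torus.partialDeriv i (complexify ∘ u) z) y := by
    funext y
    simp only [Function.comp_apply, map_sum]
    refine Finset.sum_congr rfl fun i _ => ?_
    rw [partialDeriv_complexify_comp hu, Complex.coe_smul, LinearIsometry.map_smul]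
  rw [e, mFourierCoeff_finset_sum (f := fun i y => ((dir i : ℝ) : ℂ) • Torus.partialDeriv i (complexify ∘ u) y) _
    (fun i _ => (hterm i).integrable), Finset.mul_sum, Finset.sum_smul]
  refine Finset.sum_congr rfl fun i _ => ?_
  rw [show (fun y => ((dir i : ℝ) : ℂ) • Torus.partialDeriv i (complexify ∘ u) y) =
      ((dir i : ℝ) : ℂ) • Torus.partialDeriv i (complexify ∘ u) from rfl, mFourierCoeff_const_smul,
    mFourierCoeff_partialDeriv hu.complexify_comp i k, smul_smul]
  congr 1
  push_cast
  ring

/-- The directional derivative `∑ᵢ dirᵢ ∂ᵢu` of a smooth field is smooth. [folklore] -/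
theorem isSmooth_dirDeriv {u : (UnitAddTorus (Fin 3)) → (EuclideanSpace ℝ (Fin 3))} (hu : IsSmooth u) (dir : Fin 3 →
    ℤ) :
    IsSmooth (fun y => ∑ i, (dir i : ℝ) • Torus.partialDeriv i u y) := by
  have hterm : ∀ i, IsSmooth (fun y => (dir i : ℝ) • Torus.partialDeriv i u y) := fun i =>
    (hu.partialDeriv i).const_smul _
  have h := ContDiff.sum (s := (Finset.univ : Finset (Fin 3))) (fun i _ => hterm i)
  exact h

variable {W : Submodule ℝ (lp (fun _ : Fin 3 → ℤ => EuclideanSpace ℂ (Fin 3)) 2)}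
  (hW : ∀ x : (lp (fun _ : Fin 3 → ℤ => EuclideanSpace ℂ (Fin 3)) 2), x ∈ W ↔ ((x : (Fin 3 → ℤ) → (EuclideanSpace ℂ
      (Fin 3))) 0 = 0 ∧ (∀ k : (Fin 3 → ℤ), (∑ jj : Fin 3, ((k jj : ℤ) : ℂ) * ((x : (Fin 3 → ℤ) → (EuclideanSpace ℂ
      (Fin 3))) k) jj) = 0) ∧
    IsConjSymm (x : (Fin 3 → ℤ) → (EuclideanSpace ℂ (Fin 3)))))
include hW

/-- **The Goldstone vector in the state space**: for a smooth divergence-free `u` and a lattice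
direction `dir`, the family `k ↦ |k|² 𝓕(∑ᵢ dirᵢ ∂ᵢu)(k)` is an element `g ∈ W` with
`ǧ = cf g = 𝓕(∑ᵢ dirᵢ ∂ᵢu)`. [folklore] -/
theorem exists_dirDerivVec {u : (UnitAddTorus (Fin 3)) → (EuclideanSpace ℝ (Fin 3))} (hu : IsSmooth u) (hdiv :
    IsDivFree u) (dir : Fin 3 → ℤ) :
    ∃ g : W, ((fun mm : Fin 3 → ℤ => (((freqNormSq mm)⁻¹ : ℝ) : ℂ)) • (((g : (lp (fun _ : Fin 3 → ℤ => EuclideanSpace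
        ℂ (Fin 3)) 2)) : (Fin 3 → ℤ) → (EuclideanSpace ℂ (Fin 3))) : (Fin 3 → ℤ) → EuclideanSpace ℂ (Fin 3))) =
        mFourierCoeff (complexify ∘ fun y => ∑ i, (dir i : ℝ) • Torus.partialDeriv i u y) := by
  set V : (Fin 3 → ℤ) → (EuclideanSpace ℂ (Fin 3)) := mFourierCoeff (complexify ∘ fun y => ∑ i, (dir i : ℝ) •
      Torus.partialDeriv i u y) with hV
  have hv : IsSmooth (fun y => ∑ i, (dir i : ℝ) • Torus.partialDeriv i u y) := isSmooth_dirDeriv hu dir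
  have hVr : RapidDecay V := hv.complexify_comp.rapidDecay_mFourierCoeff
  have hVcs : IsConjSymm V := isConjSymm_mFourierCoeff hv.integrable
  have hat : ∀ m : (Fin 3 → ℤ), (∑ jj : Fin 3, ((m jj : ℤ) : ℂ) * (mFourierCoeff (complexify ∘ u) m) jj) = 0 :=
      fun m =>
    hdiv.sum_mul_mFourierCoeff_eq_zero hu m
  have hVk : ∀ k, V k = (2 * Real.pi * Complex.I * (∑ i, ((k i : ℤ) : ℂ) * ((dir i : ℤ) : ℂ))) •
      mFourierCoeff (complexify ∘ u) k := fun k => mFourierCoeff_dirDeriv hu dir k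
  have hV0 : V 0 = 0 := by rw [hVk]; simp
  have hVt : ∀ k : (Fin 3 → ℤ), (∑ jj : Fin 3, ((k jj : ℤ) : ℂ) * (V k) jj) = 0 := fun k => by rw [hVk, kdot_smul, hat
      k, mul_zero]
  set X : (Fin 3 → ℤ) → (EuclideanSpace ℂ (Fin 3)) := fun k => ((freqNormSq k : ℝ) : ℂ) • V k with hX
  have hXr : RapidDecay X := by
    refine hVr.of_norm_le_mul_pow (C := 1) (s := 1) fun k => ?_
    rw [hX]
    dsimp only
    rw [norm_smul, Complex.norm_real, Real.norm_of_nonneg (freqNormSq_nonneg k), one_mul, pow_one]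
    exact mul_le_mul_of_nonneg_right (by linarith [freqNormSq_nonneg k]) (norm_nonneg _)
  have hXV : X 0 = 0 ∧ (∀ k : (Fin 3 → ℤ), (∑ jj : Fin 3, ((k jj : ℤ) : ℂ) * (X k) jj) = 0) ∧ IsConjSymm X := by
    refine ⟨by simp [hX, freqNormSq_zero], fun k => by rw [hX]; dsimp only; rw [kdot_smul, hVt k, mul_zero],
      fun k => ?_⟩
    rw [hX]
    dsimp only
    rw [freqNormSq_neg, hVcs k, conjVec_smul, Complex.conj_ofReal]
  refine ⟨⟨⟨X, memℓp_two_of_rapidDecay hXr⟩, (hW _).2 hXV⟩, ?_⟩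
  change ((fun mm : Fin 3 → ℤ => (((freqNormSq mm)⁻¹ : ℝ) : ℂ)) • (X : (Fin 3 → ℤ) → EuclideanSpace ℂ (Fin 3))) = V
  rw [hX]
  exact cf_weight_smul hV0

end Packaged

end SteadyLattice

end Literature.Analysis.FluidPDE

end
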